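import Summits.Ventures.Crystal3D.Theorems.StickyWulffConstantPolycrystalWulffBoundDichotomyArith

/-!
# `PolycrystalWulffBound`: arithmetic of the SECOND pincer (per-class Wulff + wall over-count)

Route `StickyWulffConstant` of the venture `Summits/Ventures/Crystal3D`, crux `PolycrystalWulffBound`
(item `stmt-Ventures-19482`), second prover lane (poly-p2).  Companion of `…DichotomyArith.lean`
(Mathlib-only import cone).  The fine twin-free corner of line PolyDensity has TWO crude lower bounds
for the energy of a polyhedral texture whose lattice classes have volumes `v ℓ` (`V = Σ v ℓ`), free
area `F = Per(E)` and inter-class wall term `D = Σ_{f,g in different classes} ι_B(G f, G g)`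
(twice the wall area):

* (first pincer, P-LINE §3)  `En ≥ √3·F + D/2`  (free tension `≥ √3`, generic walls charged `≥ 1`);
* (second pincer, P-LINE §3 `rung_twinFree` tools: «per-grain Wulff with wall over-count
  ≤ (2√5 − 1)·area»)  `En ≥ Σ_ℓ 6·2^{1/3}(√2 v ℓ)^{2/3} − (√5 − 1/2)·D`.

`second_pincer_arith`: both together with `F ≥ c V^{2/3}` (`c³ ≥ 36π`) and every class `≤ V/3`
give `6·2^{1/3}(√2 V)^{2/3} ≤ En` (weights `0.2235 / 0.7765`; margin `9.572 ≥ 9.525`; the pair of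
bounds stops working at class fraction `0.3503`).  Decimal brackets `cbrt_three_lower`,
`sqrt_five_upper`.
WHAT THIS IS NOT: any statement about sets or perimeters; nothing on the crux beyond this corner.
-/

noncomputable section

namespace Summit.Ventures.Crystal3D.Theorems

open Real Finset

/-- `1.4422 ≤ 3^{1/3}`. -/
theorem cbrt_three_lower : (1.4422 : ℝ) ≤ (3 : ℝ) ^ ((1 : ℝ) / 3) := by
  set r : ℝ := (3 : ℝ) ^ ((1 : ℝ) / 3) with hr
  have hr0 : 0 ≤ r := by positivity
  have hr3 : r ^ 3 = 3 := by
    rw [hr, ← Real.rpow_mul_natCast (by norm_num)]; norm_num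
  by_contra h
  rw [not_le] at h
  have h3 : r ^ 3 < (1.4422 : ℝ) ^ 3 := by gcongr
  norm_num at h3
  linarith

/-- `√5 ≤ 2.2361`. -/
theorem sqrt_five_upper : Real.sqrt 5 ≤ (2.2361 : ℝ) := by
  rw [show (2.2361 : ℝ) = Real.sqrt (2.2361 ^ 2) by rw [Real.sqrt_sq (by norm_num)]]
  exact Real.sqrt_le_sqrt (by norm_num)

/-- **Second pincer (arithmetic).**  Let `c > 0` with `c³ ≥ 36π`, class volumes `0 ≤ v ℓ ≤ V/3`
with `V = Σ v ℓ`, free area `F ≥ c V^{2/3}`, `D ≥ 0`, and an energy `En` with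
`√3 F + D/2 ≤ En` (first pincer) and `Σ_ℓ 6·2^{1/3}(√2 v ℓ)^{2/3} − (√5 − 1/2) D ≤ En` (second
pincer).  Then `6·2^{1/3}(√2 V)^{2/3} ≤ En`. -/
theorem second_pincer_arith {ι : Type*} (s : Finset ι) {v : ι → ℝ} {c V F D En : ℝ} (hc : 0 < c)
    (hc3 : 36 * Real.pi ≤ c ^ 3) (hV : V = ∑ i ∈ s, v i) (hv : ∀ i ∈ s, 0 ≤ v i)
    (hsmall : ∀ i ∈ s, v i ≤ 1 / 3 * V) (hF : c * V ^ ((2 : ℝ) / 3) ≤ F) (hD : 0 ≤ D)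
    (h1 : Real.sqrt 3 * F + D / 2 ≤ En)
    (h2 : (∑ i ∈ s, 6 * (2 : ℝ) ^ ((1 : ℝ) / 3) * (Real.sqrt 2 * v i) ^ ((2 : ℝ) / 3)) -
      (Real.sqrt 5 - 1 / 2) * D ≤ En) :
    6 * (2 : ℝ) ^ ((1 : ℝ) / 3) * (Real.sqrt 2 * V) ^ ((2 : ℝ) / 3) ≤ En := by
  have hV0 : 0 ≤ V := by rw [hV]; exact sum_nonneg hv
  rw [wulffConstant_eq' hV0]
  obtain ⟨ht1, ht2, -⟩ := cbrt_two_bounds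
  set t : ℝ := (2 : ℝ) ^ ((1 : ℝ) / 3) with ht
  have ht0 : 0 ≤ t := by positivity
  -- the concavity gain with `α = 1/3`: `Σ (v i)^{2/3} ≥ 3^{1/3} V^{2/3}`
  have hgain := sum_rpow_two_thirds_ge s (by norm_num : (0 : ℝ) < 1 / 3) hV hv hsmall
  have hα : (1 / 3 : ℝ) ^ (-(1 : ℝ) / 3) = (3 : ℝ) ^ ((1 : ℝ) / 3) := by
    rw [show (1 / 3 : ℝ) = (3 : ℝ)⁻¹ by norm_num, Real.inv_rpow (by norm_num), ← Real.rpow_neg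
      (by norm_num)]
    norm_num
  rw [hα] at hgain
  set r : ℝ := (3 : ℝ) ^ ((1 : ℝ) / 3) with hr
  have hr1 : (1.4422 : ℝ) ≤ r := cbrt_three_lower
  have hr0 : 0 ≤ r := by positivity
  set W : ℝ := V ^ ((2 : ℝ) / 3) with hW
  have hW0 : 0 ≤ W := by positivity
  set Q : ℝ := ∑ i ∈ s, v i ^ ((2 : ℝ) / 3) with hQ
  have hQ0 : 0 ≤ Q := sum_nonneg fun i hi => Real.rpow_nonneg (hv i hi) _
  -- the second pincer in terms of `Q`
  have hsum : (∑ i ∈ s, 6 * (2 : ℝ) ^ ((1 : ℝ) / 3) * (Real.sqrt 2 * v i) ^ ((2 : ℝ) / 3)) =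
      6 * t ^ 2 * Q := by
    rw [hQ, mul_sum]
    refine sum_congr rfl fun i hi => ?_
    rw [wulffConstant_eq' (hv i hi)]
  rw [hsum] at h2
  -- decimal brackets
  have h3 : (1.732 : ℝ) ≤ Real.sqrt 3 := sqrt_three_lower
  have h5 : Real.sqrt 5 ≤ (2.2361 : ℝ) := sqrt_five_upper
  have hc1 : (4.835 : ℝ) ≤ c := isoConst_lower hc hc3
  -- products, as linear facts
  have hFW : c * W ≤ F := hF
  have p1 : Real.sqrt 5 * D ≤ 2.2361 * D := mul_le_mul_of_nonneg_right h5 hD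
  have p2 : t ^ 2 * (r * W) ≤ t ^ 2 * Q := mul_le_mul_of_nonneg_left hgain (sq_nonneg t)
  have ht2l : (1.2599 : ℝ) ^ 2 ≤ t ^ 2 := by gcongr
  have ht2u : t ^ 2 ≤ (1.25993 : ℝ) ^ 2 := by gcongr
  have p3 : (1.2599 : ℝ) ^ 2 * (r * W) ≤ t ^ 2 * (r * W) :=
    mul_le_mul_of_nonneg_right ht2l (mul_nonneg hr0 hW0)
  have p4 : (1.4422 : ℝ) * W ≤ r * W := mul_le_mul_of_nonneg_right hr1 hW0
  have p5 : Real.sqrt 3 * (c * W) ≤ Real.sqrt 3 * F := mul_le_mul_of_nonneg_left hFW (Real.sqrt_nonneg 3)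
  have p6 : (1.732 : ℝ) * (c * W) ≤ Real.sqrt 3 * (c * W) :=
    mul_le_mul_of_nonneg_right h3 (mul_nonneg hc.le hW0)
  have p7 : (4.835 : ℝ) * W ≤ c * W := mul_le_mul_of_nonneg_right hc1 hW0
  have p8 : t ^ 2 * W ≤ (1.25993 : ℝ) ^ 2 * W := mul_le_mul_of_nonneg_right ht2u hW0
  nlinarith [p1, p2, p3, p4, p5, p6, p7, p8, hD, hW0, hQ0, h1, h2]

end Summit.Ventures.Crystal3D.Theorems

end
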